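import Mathlib.MeasureTheory.Measure.Count
import Mathlib.Analysis.SpecialFunctions.Log.Basic
import Literature.IUT.LogThetaLattice.PacketWeights
import HarnessLib

/-!
# [IUTchIII] Remark 3.1.1 (iii): weighted sums of log-volumes are NOT, in general, logarithms of measures — a kernel
# witness (proof-only companion of `PacketWeights.lean`)

S. Mochizuki, *Inter-universal Teichmüller theory III*, kurims manuscript (May 2020) `paper:url-4b091feeb646`, §3,
Remark 3.1.1 (iii) p. 95 l. 11–17 [claim: Mochizuki2012, status: disputed]: "observe that care must be exercised when
considering the various weighted sums of log-volumes discussed in (ii), since, unlike, for instance, the log-volumes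
discussed in [item (a) of] [AbsTopIII], Proposition 5.7, (i), (ii), such weighted sums of log-volumes do not, in
general, arise as some positive real multiple of the [natural] logarithm of a 'volume' or 'measure' in the usual sense
of measure theory." abc-iut cell, layer L6, seat abc-iut-L6-t4 (typer of record of [IUTchIII] §3; gen 5); PROOF-ONLY
companion (no `def`, no named fact) of my gen-0 `PacketWeights.lean` (p403744: the normalized weights of (ii), the
direct product regions of (iii), the `E`-weighted measure of (iv)).

WHAT IS PROVED — a WITNESS of the printed "do not, in general": two direct summands `M₁ = M₂ =` a two-point space with
counting measure and the UNEQUAL weights `1` and `1/2` (the shape of (ii)'s weights `[K_v : (F_mod)_v]⁻¹` at two places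
with different local degrees). If some measure `ν` on `M₁ × M₂` and some `c > 0` reproduced the weighted sum
`1·log μ₁(S₁) + ½·log μ₂(S₂) = c·log ν(S₁ × S₂)` on all direct product regions (nonempty `S₁, S₂`; every nonempty subset
of a finite discrete space is compact of positive counting measure), then the four "strips" `M₁ × {b}`, `{a} × M₂` would
have `ν`-masses `2^{1/c}` resp. `2^{1/(2c)}`, and additivity of `ν` (`ν(M₁ × M₂) = Σ_b ν(M₁ × {b}) = Σ_a ν({a} × M₂)`) forces
`2^{1/c} = 2^{1/(2c)}`, i.e. `log 2 = 0` — `Remark311iii_weightedSum_not_log_measure`. (With EQUAL weights `w` the weighted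
sum IS `w · log` of the product measure — the [AbsTopIII] Prop. 5.7 situation the remark contrasts with; the `E`-weighted
measure of (iv) is the device that restores a measure-theoretic reading, `PacketWeights.weightedMeasure_log_directProduct`.)

Classical measure theory on a four-point space; nothing here bears on [IUTchIII] Cor. 3.12 or takes a side.
-/

noncomputable section

namespace Literature.IUT.LogThetaLattice

open MeasureTheory Set

/-- For a measure `ν` on `Bool × Bool`: `ν univ = ν (univ ×ˢ {true}) + ν (univ ×ˢ {false})`. [folklore] -/
private theorem measure_univ_eq_rows (ν : Measure (Bool × Bool)) :
    ν univ = ν (univ ×ˢ {true}) + ν (univ ×ˢ {false}) := by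
  rw [← measure_union _ (MeasurableSet.univ.prod (measurableSet_singleton false))]
  · congr 1
    ext ⟨a, b⟩
    cases b <;> simp
  · rw [Set.disjoint_left]
    rintro ⟨a, b⟩ h1 h2
    simp only [mem_prod, mem_univ, mem_singleton_iff, true_and] at h1 h2
    exact Bool.noConfusion (h1.symm.trans h2)

/-- For a measure `ν` on `Bool × Bool`: `ν univ = ν ({true} ×ˢ univ) + ν ({false} ×ˢ univ)`. [folklore] -/
private theorem measure_univ_eq_cols (ν : Measure (Bool × Bool)) :
    ν univ = ν ({true} ×ˢ univ) + ν ({false} ×ˢ univ) := by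
  rw [← measure_union _ ((measurableSet_singleton false).prod MeasurableSet.univ)]
  · congr 1
    ext ⟨a, b⟩
    cases a <;> simp
  · rw [Set.disjoint_left]
    rintro ⟨a, b⟩ h1 h2
    simp only [mem_prod, mem_univ, mem_singleton_iff, and_true] at h1 h2
    exact Bool.noConfusion (h1.symm.trans h2)

/-- If `log 2 = c · log x.toReal` with `c > 0` (`x : ℝ≥0∞`), then `x` is finite and `x.toReal = exp (log 2 / c)`. [folklore] -/
private theorem toReal_eq_exp_of_log_eq {c L : ℝ} (hc : 0 < c) (hL : L ≠ 0) {x : ENNReal}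
    (h : L = c * Real.log x.toReal) : x ≠ ⊤ ∧ x.toReal = Real.exp (L / c) := by
  have hlog : Real.log x.toReal = L / c := by
    field_simp
    linarith [h]
  have hpos : 0 < x.toReal := by
    rcases lt_or_ge 0 x.toReal with hx | hx
    · exact hx
    · exfalso
      have : x.toReal = 0 := le_antisymm hx ENNReal.toReal_nonneg
      rw [this, Real.log_zero] at hlog
      exact hL (by field_simp at hlog; linarith [hlog])
  refine ⟨?_, ?_⟩
  · intro htop
    rw [htop, ENNReal.toReal_top] at hpos
    exact lt_irrefl _ hpos
  · rw [← hlog, Real.exp_log hpos]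

/-- **[IUTchIII] Remark 3.1.1 (iii) — "such weighted sums of log-volumes do not, in general, arise as some positive real
multiple of the [natural] logarithm of a 'volume' or 'measure'"** (p. 95 l. 11–17), WITNESSED: for two two-point direct
summands with counting measures and the unequal weights `1`, `½` of Remark 3.1.1 (ii)'s shape, NO measure `ν` on the product
and NO `c > 0` satisfy `1·log μ₁(S₁) + ½·log μ₂(S₂) = c·log ν(S₁ × S₂)` for all direct product regions `S₁ × S₂` (nonempty = compact
of positive measure here). PROVED (additivity of `ν` along rows and along columns forces `2^{1/c} = 2^{1/(2c)}`).
[cite: Mochizuki2012, Rmk. 3.1.1 (iii) p.95] [claim: Mochizuki2012, status: disputed] -/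
theorem Remark311iii_weightedSum_not_log_measure :
    ¬ ∃ c : ℝ, 0 < c ∧ ∃ ν : Measure (Bool × Bool), ∀ S₁ S₂ : Set Bool, S₁.Nonempty → S₂.Nonempty →
      (1 : ℝ) * Real.log (Measure.count S₁).toReal + (1 / 2 : ℝ) * Real.log (Measure.count S₂).toReal =
        c * Real.log (ν (S₁ ×ˢ S₂)).toReal := by
  rintro ⟨c, hc, ν, h⟩
  have hL : Real.log 2 ≠ 0 := Real.log_ne_zero_of_pos_of_ne_one two_pos (by norm_num)
  have hcu : (Measure.count (univ : Set Bool)).toReal = 2 := by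
    rw [← Finset.coe_univ, Measure.count_apply_finset, Finset.card_univ, Fintype.card_bool]
    norm_num
  have hcs : ∀ b : Bool, (Measure.count ({b} : Set Bool)).toReal = 1 := fun b => by
    rw [Measure.count_singleton]
    exact ENNReal.toReal_one
  -- rows `univ ×ˢ {b}`: `log 2 = c · log ν(row)`
  have hrow : ∀ b : Bool, Real.log 2 = c * Real.log (ν (univ ×ˢ {b})).toReal := fun b => by
    have := h univ {b} univ_nonempty (singleton_nonempty b)
    rw [hcu, hcs, Real.log_one, mul_zero, add_zero, one_mul] at this
    exact this
  -- columns `{a} ×ˢ univ`: `½ · log 2 = c · log ν(col)`, i.e. `log 2 = (2c) · log ν(col)`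
  have hcol : ∀ a : Bool, Real.log 2 = (2 * c) * Real.log (ν ({a} ×ˢ univ)).toReal := fun a => by
    have := h {a} univ (singleton_nonempty a) univ_nonempty
    rw [hcu, hcs, Real.log_one, mul_zero, zero_add] at this
    linarith [this]
  have hr := fun b => toReal_eq_exp_of_log_eq hc hL (hrow b)
  have hk := fun a => toReal_eq_exp_of_log_eq (by linarith : 0 < 2 * c) hL (hcol a)
  -- additivity of `ν` along rows and along columns
  have e1 : (ν univ).toReal = Real.exp (Real.log 2 / c) + Real.exp (Real.log 2 / c) := by
    rw [measure_univ_eq_rows, ENNReal.toReal_add (hr true).1 (hr false).1, (hr true).2, (hr false).2]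
  have e2 : (ν univ).toReal = Real.exp (Real.log 2 / (2 * c)) + Real.exp (Real.log 2 / (2 * c)) := by
    rw [measure_univ_eq_cols, ENNReal.toReal_add (hk true).1 (hk false).1, (hk true).2, (hk false).2]
  have hexp : Real.exp (Real.log 2 / c) = Real.exp (Real.log 2 / (2 * c)) := by linarith [e1, e2]
  have := Real.exp_injective hexp
  field_simp at this
  exact hL (by linarith [this])

/-- By contrast, with EQUAL weights the weighted sum IS a positive multiple of the logarithm of a measure — the product
(counting) measure: `w·log μ₁(S₁) + w·log μ₂(S₂) = w·log (μ₁ ⊗ μ₂)(S₁ × S₂)` for finite nonempty `S₁, S₂` (the [AbsTopIII]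
Prop. 5.7 situation Remark 3.1.1 (iii) contrasts with; the unequal-weight case is repaired by the `E`-weighted measure of
(iv), `PacketWeights.weightedMeasure_log_directProduct`). [cite: Mochizuki2012, Rmk. 3.1.1 (iii) p.95]
[claim: Mochizuki2012, status: disputed] -/
theorem Remark311iii_equalWeights_log_prod (w : ℝ) (S₁ S₂ : Finset Bool) (h₁ : S₁.Nonempty) (h₂ : S₂.Nonempty) :
    w * Real.log (Measure.count (S₁ : Set Bool)).toReal + w * Real.log (Measure.count (S₂ : Set Bool)).toReal =
      w * Real.log ((Measure.count (S₁ : Set Bool)).toReal * (Measure.count (S₂ : Set Bool)).toReal) := by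
  rw [← mul_add, ← Real.log_mul]
  · rw [Measure.count_apply_finset, ENNReal.toReal_natCast]
    exact_mod_cast h₁.card_pos.ne'
  · rw [Measure.count_apply_finset, ENNReal.toReal_natCast]
    exact_mod_cast h₂.card_pos.ne'

end Literature.IUT.LogThetaLattice

end
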